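import Mathlib
import Summits.Ventures.HodgeRepro2.T7SupportTwoTorusInvariant

/-!
# Tier7/Line3/DetSection — the determinant section of Lemma WA′, in p1's hermitian-plane vocabulary

Filer: t7-L1-p3 (gen 4, prover-pub-hodge-repro2-t7-L1-p3-g4-0), TARGET line STATUS l. 15360 (sixth target). Lane: SUPPORT for Line 3's
version-(ii) chain (L3-ARGUMENT.md v13/v14 §2f, the `a_γ₀ ≠ 0` row: Lemma WA′ — Tier7/Line3/DensityTransfer p676334
`dense_of_approximations` takes, at every place, a CONTINUOUS SECTION `s v : N v → G v` of the determinant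
`det v : G v →* N v` (plan-2 l. 15174 «the det section»: `u ↦ diag(u, 1)` in an orthogonal basis of the hermitian
plane `W_A`)); NOT a line, NOT a device.

WHAT IT SUPPLIES. Over any field `E` with a ring involution `σ` and a diagonal hermitian form `herm σ d` on `E²`
(p1's `T7SupportTwoTorusInvariant`, row 662 — the adapted coordinates of `W_A ⊗ F_v` at every place):

* (D1) `isIsom_diagonal` — a diagonal matrix with norm-one entries (`nrm σ (a i) = 1`) is an isometry of `herm σ d`;
  `isIsom_one` / `isIsom_mul` / `isIsom_inv` — the isometries among the invertible matrices form a group.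
* (D2) `isomGroup σ d ≤ (Matrix (Fin 2) (Fin 2) E)ˣ` — THE UNITARY GROUP `U(herm σ d)` of the form as a subgroup of
  `GL₂(E)`; `normOne σ ≤ Eˣ` — the norm-one group `{u | u σ(u) = 1}` (= `E¹_v`, the kernel of `nrm`);
  `detHom σ d : isomGroup σ d →* Eˣ` — the determinant (`Matrix.detMonoidHom` on units, restricted);
  `det_mem_normOne` — the determinant of an isometry has norm one (`det` of `gᴴ D g = D`).
* (D3) `detSection σ d : normOne σ → isomGroup σ d` — THE SECTION `u ↦ diag(u, 1)`; `detHom_detSection`: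
  `det (diag(u, 1)) = u` — `detHom ∘ detSection = id`.
* (D4) `continuous_detSection` — for `E` a topological ring, the section is CONTINUOUS (`Units.continuous_iff` on
  `GL₂(E) ⊆ M₂(E) × M₂(E)`: both `diag(u, 1)` and its inverse `diag(u⁻¹, 1)` are continuous in the unit `u`).
  `exists_continuous_section_det` — the displayed `(s v, hs v, hdet_s v)` of `dense_of_approximations`, with
  `G v = isomGroup σ d`, `N v = normOne σ`, `det v = detHom σ d`, at every place.

NOT in this file: that `U(W_A)(F_v)` IS `isomGroup σ_v d` in the adapted coordinates (the dictionary, KappaNatural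
record (2): one orthogonal basis for the det section and for `κ`), the identification of `normOne σ` with
`LocalHilbert90`'s `(Units.map (Algebra.norm F)).ker` (`N_{E/F}(u) = u σ(u)` for the quadratic extension — Galois
bookkeeping, in words), anything about `X`; nothing about the step (P) is claimed.

§8(d) (uses an L-value-free non-vanishing device): NO — linear algebra of the hermitian plane.
-/

namespace Summit.Ventures.HodgeRepro2.Tier7.Line3.DetSection

open Matrix Summit.Ventures.HodgeRepro2.T7SupportTwoTorusInvariant

section Algebra

variable {E : Type*} [Field E] (σ : E →+* E)

/-- (D1) A diagonal matrix whose entries have norm one is an isometry of `herm σ d`. -/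
theorem isIsom_diagonal (d : Fin 2 → E) (a : Fin 2 → E) (ha : ∀ i, nrm σ (a i) = 1) :
    IsIsom σ d (diagonal a) := by
  intro x y
  simp only [herm, mulVec_diagonal, map_mul]
  refine Finset.sum_congr rfl fun i _ => ?_
  have h := ha i
  simp only [nrm] at h
  calc d i * (a i * x i * (σ (a i) * σ (y i)))
      = d i * (x i * σ (y i)) * (a i * σ (a i)) := by ring
    _ = d i * (x i * σ (y i)) := by rw [h, mul_one]

/-- (D1) The identity is an isometry. -/
theorem isIsom_one (d : Fin 2 → E) : IsIsom σ d (1 : Matrix (Fin 2) (Fin 2) E) := by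
  intro x y
  simp only [one_mulVec]

/-- (D1) Isometries are closed under products. -/
theorem isIsom_mul {d : Fin 2 → E} {g h : Matrix (Fin 2) (Fin 2) E} (hg : IsIsom σ d g)
    (hh : IsIsom σ d h) : IsIsom σ d (g * h) := by
  intro x y
  rw [← mulVec_mulVec, ← mulVec_mulVec, hg, hh]

/-- (D1) The inverse of an invertible isometry is an isometry. -/
theorem isIsom_inv {d : Fin 2 → E} (g : (Matrix (Fin 2) (Fin 2) E)ˣ)
    (hg : IsIsom σ d (g : Matrix (Fin 2) (Fin 2) E)) :
    IsIsom σ d ((g⁻¹ : (Matrix (Fin 2) (Fin 2) E)ˣ) : Matrix (Fin 2) (Fin 2) E) := by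
  intro x y
  have h := hg ((g⁻¹ : (Matrix (Fin 2) (Fin 2) E)ˣ) *ᵥ x) ((g⁻¹ : (Matrix (Fin 2) (Fin 2) E)ˣ) *ᵥ y)
  rw [mulVec_mulVec, mulVec_mulVec, Units.mul_inv, one_mulVec, one_mulVec] at h
  exact h.symm

/-- (D2) THE UNITARY GROUP of the hermitian form `herm σ d`: the invertible isometries, as a
subgroup of `GL₂(E) = (Matrix (Fin 2) (Fin 2) E)ˣ`. -/
def isomGroup (d : Fin 2 → E) : Subgroup (Matrix (Fin 2) (Fin 2) E)ˣ where
  carrier := {g | IsIsom σ d (g : Matrix (Fin 2) (Fin 2) E)}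
  mul_mem' {g h} hg hh := by
    simp only [Set.mem_setOf_eq, Units.val_mul] at hg hh ⊢
    exact isIsom_mul σ hg hh
  one_mem' := by
    simp only [Set.mem_setOf_eq, Units.val_one]
    exact isIsom_one σ d
  inv_mem' {g} hg := by
    simp only [Set.mem_setOf_eq] at hg ⊢
    exact isIsom_inv σ g hg

/-- Membership in the unitary group. -/
theorem mem_isomGroup_iff (d : Fin 2 → E) (g : (Matrix (Fin 2) (Fin 2) E)ˣ) :
    g ∈ isomGroup σ d ↔ IsIsom σ d (g : Matrix (Fin 2) (Fin 2) E) := Iff.rfl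

/-- (D2) THE NORM-ONE GROUP `{u | u σ(u) = 1}` of the involution, as a subgroup of `Eˣ`. -/
def normOne : Subgroup Eˣ where
  carrier := {u | nrm σ (u : E) = 1}
  mul_mem' {u v} hu hv := by
    simp only [Set.mem_setOf_eq, Units.val_mul] at hu hv ⊢
    rw [nrm_mul, hu, hv, mul_one]
  one_mem' := by
    simp only [Set.mem_setOf_eq, Units.val_one]
    exact nrm_one σ
  inv_mem' {u} hu := by
    simp only [Set.mem_setOf_eq] at hu ⊢
    rw [Units.val_inv_eq_inv_val, ← one_div, nrm_div, nrm_one, hu, one_div_one]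

/-- Membership in the norm-one group. -/
theorem mem_normOne_iff (u : Eˣ) : u ∈ normOne σ ↔ nrm σ (u : E) = 1 := Iff.rfl

/-- (D2) THE DETERMINANT of the unitary group, as a group homomorphism to `Eˣ`. -/
def detHom (d : Fin 2 → E) : isomGroup σ d →* Eˣ :=
  (Units.map (detMonoidHom : Matrix (Fin 2) (Fin 2) E →* E)).comp (isomGroup σ d).subtype

/-- The determinant homomorphism, on values. -/
theorem detHom_apply (d : Fin 2 → E) (g : isomGroup σ d) :
    ((detHom σ d g : Eˣ) : E) = det ((g : (Matrix (Fin 2) (Fin 2) E)ˣ) : Matrix (Fin 2) (Fin 2) E) := rfl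

/-- The Gram identity of an isometry on the standard basis vectors:
`∑ k, d k * (g k i * σ (g k j)) = δ_{ij} d i`. -/
theorem isIsom_gram {d : Fin 2 → E} {g : Matrix (Fin 2) (Fin 2) E} (hg : IsIsom σ d g) (i j : Fin 2) :
    ∑ k, d k * (g k i * σ (g k j)) = if i = j then d i else 0 := by
  have h := hg (Pi.single i 1) (Pi.single j 1)
  rw [mulVec_single_one, mulVec_single_one] at h
  simp only [herm, col_apply, Pi.single_apply] at h
  rw [h]
  by_cases hij : i = j
  · subst hij
    simp
  · simp [hij, Ne.symm hij]

/-- The Gram identity as a matrix identity: `(g.map σ)ᵀ * diagonal d * g = diagonal d`. -/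
theorem gramMatrix_eq {d : Fin 2 → E} {g : Matrix (Fin 2) (Fin 2) E} (hg : IsIsom σ d g) :
    (g.map σ)ᵀ * diagonal d * g = diagonal d := by
  ext i j
  have h := isIsom_gram σ hg j i
  have hl : ((g.map σ)ᵀ * diagonal d * g) i j = ∑ k, d k * (g k j * σ (g k i)) := by
    simp only [Matrix.mul_apply, transpose_apply, map_apply, diagonal_apply, mul_ite, mul_zero,
      Finset.sum_ite_eq', Finset.mem_univ, if_true]
    refine Finset.sum_congr rfl fun k _ => ?_
    ring
  rw [hl, h, diagonal_apply]
  by_cases hij : i = j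
  · subst hij
    simp
  · simp [hij, Ne.symm hij]

/-- (D2) The determinant of an isometry has norm one: `det g · σ(det g) = 1` (take determinants in
`(g.map σ)ᵀ D g = D` with `∏ d i ≠ 0`). -/
theorem det_mem_normOne (d : Fin 2 → E) (hd : ∀ i, d i ≠ 0) (g : isomGroup σ d) :
    detHom σ d g ∈ normOne σ := by
  rw [mem_normOne_iff, detHom_apply]
  have hg : IsIsom σ d ((g : (Matrix (Fin 2) (Fin 2) E)ˣ) : Matrix (Fin 2) (Fin 2) E) := g.2
  have hdet := congrArg det (gramMatrix_eq σ hg)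
  rw [det_mul, det_mul, det_transpose, det_diagonal, ← RingHom.mapMatrix_apply, ← RingHom.map_det] at hdet
  have hd0 : ∏ i, d i ≠ 0 := Finset.prod_ne_zero_iff.mpr fun i _ => hd i
  have key : nrm σ (det ((g : (Matrix (Fin 2) (Fin 2) E)ˣ) : Matrix (Fin 2) (Fin 2) E)) * (∏ i, d i) =
      1 * (∏ i, d i) := by
    calc nrm σ (det ((g : (Matrix (Fin 2) (Fin 2) E)ˣ) : Matrix (Fin 2) (Fin 2) E)) * (∏ i, d i)
        = (σ (det ((g : (Matrix (Fin 2) (Fin 2) E)ˣ) : Matrix (Fin 2) (Fin 2) E)) * (∏ i, d i)) *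
          det ((g : (Matrix (Fin 2) (Fin 2) E)ˣ) : Matrix (Fin 2) (Fin 2) E) := by rw [nrm]; ring
      _ = ∏ i, d i := hdet
      _ = 1 * (∏ i, d i) := (one_mul _).symm
  exact mul_right_cancel₀ hd0 key

/-- (D3) THE DETERMINANT SECTION `u ↦ diag(u, 1)` : `normOne σ → isomGroup σ d`. -/
def detSection (d : Fin 2 → E) (u : normOne σ) : isomGroup σ d :=
  ⟨Units.mk (diagonal ![((u : Eˣ) : E), 1]) (diagonal ![(((u : Eˣ)⁻¹ : Eˣ) : E), 1])
      (by
        rw [diagonal_mul_diagonal, ← diagonal_one]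
        congr 1
        ext i
        fin_cases i <;> simp)
      (by
        rw [diagonal_mul_diagonal, ← diagonal_one]
        congr 1
        ext i
        fin_cases i <;> simp),
    by
      rw [mem_isomGroup_iff]
      refine isIsom_diagonal σ d _ fun i => ?_
      fin_cases i
      · exact u.2
      · exact nrm_one σ⟩

/-- The section, on the underlying matrix. -/
theorem coe_detSection (d : Fin 2 → E) (u : normOne σ) :
    (((detSection σ d u : isomGroup σ d) : (Matrix (Fin 2) (Fin 2) E)ˣ) : Matrix (Fin 2) (Fin 2) E) =
      diagonal ![((u : Eˣ) : E), 1] := rfl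

/-- (D3) `det (diag(u, 1)) = u`: the section is a section of the determinant. -/
theorem detHom_detSection (d : Fin 2 → E) (u : normOne σ) :
    detHom σ d (detSection σ d u) = (u : Eˣ) := by
  ext
  rw [detHom_apply, coe_detSection, det_diagonal, Fin.prod_univ_two]
  simp

end Algebra

section Topological

variable {E : Type*} [Field E] [TopologicalSpace E] (σ : E →+* E)

omit [TopologicalSpace E] in
/-- The inverse of the section's matrix is `diag(u⁻¹, 1)` (by construction). -/
theorem coe_inv_detSection (d : Fin 2 → E) (u : normOne σ) :
    ((((detSection σ d u : isomGroup σ d) : (Matrix (Fin 2) (Fin 2) E)ˣ)⁻¹ :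
      (Matrix (Fin 2) (Fin 2) E)ˣ) : Matrix (Fin 2) (Fin 2) E) =
      diagonal ![(((u : Eˣ)⁻¹ : Eˣ) : E), 1] := rfl

/-- `u ↦ diag(u, 1)` is continuous in the unit `u`, as a map into `M₂(E)`. -/
theorem continuous_diagonal_units :
    Continuous (fun u : Eˣ => diagonal ![((u : Eˣ) : E), 1] : Eˣ → Matrix (Fin 2) (Fin 2) E) := by
  refine Continuous.matrix_diagonal ?_
  refine continuous_pi fun i => ?_
  fin_cases i
  · exact Units.continuous_val
  · exact continuous_const

/-- `u ↦ diag(u⁻¹, 1)` is continuous in the unit `u`. -/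
theorem continuous_diagonal_units_inv :
    Continuous (fun u : Eˣ => diagonal ![(((u : Eˣ)⁻¹ : Eˣ) : E), 1] : Eˣ → Matrix (Fin 2) (Fin 2) E) := by
  refine Continuous.matrix_diagonal ?_
  refine continuous_pi fun i => ?_
  fin_cases i
  · exact Units.continuous_coe_inv
  · exact continuous_const

/-- (D4) THE SECTION IS CONTINUOUS (`Units.continuous_iff`: the matrix `diag(u, 1)` and its inverse
`diag(u⁻¹, 1)` depend continuously on `u ∈ Eˣ`). -/
theorem continuous_detSection (d : Fin 2 → E) : Continuous (detSection σ d) := by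
  refine Continuous.subtype_mk ?_ _
  rw [Units.continuous_iff]
  constructor
  · exact continuous_diagonal_units.comp continuous_subtype_val
  · exact continuous_diagonal_units_inv.comp continuous_subtype_val

/-- (D4) THE DISPLAYED INPUT `(s v, hs v, hdet_s v)` of `DensityTransfer.dense_of_approximations` at a
place, with `G v = isomGroup σ d`, `N v = normOne σ`, `det v = detHom σ d` (corestricted to `normOne σ`
by `det_mem_normOne`): a continuous section of the determinant. -/
theorem exists_continuous_section_det (d : Fin 2 → E) :
    ∃ s : normOne σ → isomGroup σ d, Continuous s ∧ ∀ u, detHom σ d (s u) = (u : Eˣ) :=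
  ⟨detSection σ d, continuous_detSection σ d, detHom_detSection σ d⟩

end Topological

end Summit.Ventures.HodgeRepro2.Tier7.Line3.DetSection
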